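import Summits.AtomisticToContinuum.HydrodynamicLimit.Theorems.CollisionIsometryCLTMacroClosureEngineIncrementBoundA
import Summits.AtomisticToContinuum.HydrodynamicLimit.Theorems.CollisionIsometryCLTMacroClosureEngineProductionBound
import Summits.AtomisticToContinuum.HydrodynamicLimit.Theorems.CollisionIsometryCLTMacroClosureEngineTrajectoryIntegrable
import Summits.AtomisticToContinuum.HydrodynamicLimit.Theorems.CollisionIsometryCLTMacroClosureEngineIncrementIdentity
import Summits.AtomisticToContinuum.HydrodynamicLimit.Theorems.CollisionIsometryCLTMacroClosureEngineJointMeasurable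
import Summits.AtomisticToContinuum.HydrodynamicLimit.Theorems.CollisionIsometryCLTMacroClosureEngineRelEntTimeIntegrable
import Summits.AtomisticToContinuum.HydrodynamicLimit.Theorems.CollisionIsometryCLTMacroClosureEngineGoodEvent
import Summits.AtomisticToContinuum.HydrodynamicLimit.Theorems.CollisionIsometryCLTMacroClosureStubClausiusStatics
import Summits.AtomisticToContinuum.HydrodynamicLimit.Theorems.CollisionIsometryCLTMacroClosureStubClausiusLimits
import HarnessLib

/-!
# Sub-goal `engine_incrementBound` of the lead's `stub_engine_pointwise` (line `IdeatorTwoGen1Sketch`, crux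
# `MacroClosure`, stmt-AtomisticToContinuum-14870): the increment bound of the barycentric Gronwall

Hypothesis (b) of the abstract Gronwall `engine_core`: on good events `G_N ⊆ good` carrying the sure bounds of
APS (i)–(ii), FMR and CTL, with pairwise distinct velocities along the flow and the eventual integrability of the
entropy / linear-statistic functionals (ledger bound `≤ 1`), there are `K ≥ 0` and `err_N → 0` with, eventually in
`N` and for all `s ≤ t`, `ℓ_N(0) − ℓ_N(s) ≤ K√M ∫₀ˢ H_N + K√M e^{−λM/4} + err_N` (`M ≥ 1`), and `H_N ≥ 0` integrable on
`[0,t]`.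

Proof (glue of the landed sure / measure-theoretic sub-goals; helpers in part A). PATHWISE on `G_N` (two particles per
band block for `N` large, so every block has positive temperature: `EngineReadout.strict_of_band`): the increment
identity `engine_incrementIdentity` (with the time-integrabilities of `engine_trajectoryIntegrable`) and the production
bound `engine_productionBound`, integrated over `[0,s]` (the block relative entropy is time-integrable:
`engine_relEntTimeIntegrable`), give `EngineIncrementBound.pathwise`. INTEGRATE over `G_N`: Tonelli in `(τ, z)`
(`engine_jointMeasurable` + `engine_incrementBound_tonelli`, with the uniform bound `H_N(τ) ≤ 1 + B₀` from the ledger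
bound and `EngineIncrementBound.ell_bound`) turns `E[1_G ∫₀ˢ X]` into `∫₀ˢ H_N`; the second moment of the energy
(`stub_clausius_moment`) pays `E(1 + e) ≤ M₀ + 2`; `err_N := δ_N⁺ + C_b r_N (2t + 2λ⁻²|Cexp|) + C_b √(δ_N⁺ t)(M₀ + 2)`.
-/

noncomputable section

open MeasureTheory Filter Set Topology InformationTheory
open scoped ENNReal ContDiff

namespace Summit.AtomisticToContinuum.HydrodynamicLimit.Theorems.MacroClosureLine

open Literature.MathematicalPhysics.KineticTheory Literature.Analysis.FluidPDE
open Literature.Analysis.FunctionSpaces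
open Summit.AtomisticToContinuum.HydrodynamicLimit.Theses

namespace Barycentric

/-- **`engine_incrementBound` (registered sub-goal of `stub_engine_pointwise`): the increment bound** (b) of the
abstract Gronwall with its integrability side conditions — see the module docstring. [cite: Dafermos2005, Thm 5.2.1] -/
theorem engine_incrementBound : ∀ (σ : ℝ), 0 < σ → σ < 2⁻¹ → StiffCollisionalRelaxation.HsFreeEnergyConvex →
    ∀ (a₀ θ₀ : T3 → ℝ) (u₀ : T3 → V3), Continuous a₀ → Continuous θ₀ → Continuous u₀ →
    (∀ x, 0 < a₀ x) → (∀ x, 0 < θ₀ x) →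
    ∀ (T : ℝ) (ρ θ : ℝ → T3 → ℝ) (u : ℝ → T3 → V3), IsHardSphereEulerSolution σ T ρ u θ →
    ∀ η₃ : ℝ, ThermoChamber η₃ → (∀ s ∈ Ico 0 T, ∀ x, ρ s x * σ ^ 3 < η₃) →
    ∀ (Φ : (N : ℕ) → Flow σ N) (γ C : ℝ) (φ : ℕ → T3 → ℝ), 0 < γ → γ ≤ 1 / 15 → AdmissibleKernel γ C φ →
    ∀ t : ℝ, 0 < t → t < T → ∀ (c₁ lam Cexp : ℝ), 0 < c₁ → c₁ * σ ^ 3 ≤ 1 → 0 < lam →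
    ∀ δs : ℕ → ℝ, Tendsto δs atTop (𝓝 0) →
    ∀ G : (N : ℕ) → Set (Config (N + 1) (Fin 3) T3), (∀ N, MeasurableSet (G N)) →
      (∀ N, G N ⊆ (Φ N).good) →
      (∀ N, ∀ z ∈ G N,
        (∫ s in Icc 0 t, ∫ y, Real.exp (lam * ‖y.2‖ ^ 2) ∂(empiricalMeasure ((Φ N).flow s z)) ≤ Cexp) ∧
        (∀ s ∈ Icc 0 t, ∀ x, c₁ ≤ bρ (φ N) ((Φ N).flow s z) x ∧ bρ (φ N) ((Φ N).flow s z) x * σ ^ 3 ≤ 1) ∧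
        (∫ s in Icc 0 t, ∫ x, ((∑ j, ∑ k, bD (φ N) ((Φ N).flow s z) x j k ^ 2) +
          ‖bq (φ N) ((Φ N).flow s z) x‖ ^ 2) ≤ δs N) ∧
        (∀ τ ∈ Icc 0 t, |ccRes θ u (Φ N) z τ -
          ∫ s in Icc 0 τ, ∫ x, ccClosure σ θ u (φ N) s ((Φ N).flow s z) x| ≤ δs N)) →
      (∀ N, ∀ z ∈ G N, ∀ τ ∈ Icc 0 t, ∀ i j : Fin (N + 1), i ≠ j →
        ((Φ N).flow τ z i).2 ≠ ((Φ N).flow τ z j).2) →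
      (∀ᶠ N : ℕ in atTop, ∀ s ∈ Icc 0 t,
        Integrable (fun z => (G N).indicator
            (fun z => ∫ x, relEnt σ (bU (φ N) ((Φ N).flow s z) x) (Ucl ρ θ u s x)) z)
          (localGibbsLaw σ a₀ u₀ θ₀ N (Φ N)) ∧
        Integrable (fun z => (G N).indicator
            (fun z => obs σ ρ θ u s ((Φ N).flow s z) - ∫ x, Lcl σ ρ θ u s x (Ucl ρ θ u s x)) z)
          (localGibbsLaw σ a₀ u₀ θ₀ N (Φ N)) ∧
        (∫ z, (G N).indicator
            (fun z => ∫ x, relEnt σ (bU (φ N) ((Φ N).flow s z) x) (Ucl ρ θ u s x)) z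
            ∂(localGibbsLaw σ a₀ u₀ θ₀ N (Φ N))) +
          ∫ z, (G N).indicator
            (fun z => obs σ ρ θ u s ((Φ N).flow s z) - ∫ x, Lcl σ ρ θ u s x (Ucl ρ θ u s x)) z
            ∂(localGibbsLaw σ a₀ u₀ θ₀ N (Φ N)) ≤ 1) →
      ∃ K : ℝ, 0 ≤ K ∧ ∃ err : ℕ → ℝ, Tendsto err atTop (𝓝 0) ∧
        (∀ᶠ N : ℕ in atTop,
          IntegrableOn (fun τ => ∫ z, (G N).indicator
              (fun z => ∫ x, relEnt σ (bU (φ N) ((Φ N).flow τ z) x) (Ucl ρ θ u τ x)) z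
              ∂(localGibbsLaw σ a₀ u₀ θ₀ N (Φ N))) (Icc 0 t) ∧
          ∀ τ ∈ Icc 0 t, 0 ≤ ∫ z, (G N).indicator
              (fun z => ∫ x, relEnt σ (bU (φ N) ((Φ N).flow τ z) x) (Ucl ρ θ u τ x)) z
              ∂(localGibbsLaw σ a₀ u₀ θ₀ N (Φ N))) ∧
        ∀ M : ℝ, 1 ≤ M → ∀ᶠ N : ℕ in atTop, ∀ s ∈ Icc 0 t,
          (∫ z, (G N).indicator
              (fun z => obs σ ρ θ u 0 ((Φ N).flow 0 z) - ∫ x, Lcl σ ρ θ u 0 x (Ucl ρ θ u 0 x)) z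
              ∂(localGibbsLaw σ a₀ u₀ θ₀ N (Φ N))) -
            ∫ z, (G N).indicator
              (fun z => obs σ ρ θ u s ((Φ N).flow s z) - ∫ x, Lcl σ ρ θ u s x (Ucl ρ θ u s x)) z
              ∂(localGibbsLaw σ a₀ u₀ θ₀ N (Φ N)) ≤
          K * Real.sqrt M * (∫ τ in Icc 0 s, ∫ z, (G N).indicator
              (fun z => ∫ x, relEnt σ (bU (φ N) ((Φ N).flow τ z) x) (Ucl ρ θ u τ x)) z
              ∂(localGibbsLaw σ a₀ u₀ θ₀ N (Φ N))) +
            K * Real.sqrt M * Real.exp (-(lam * M / 4)) + err N := by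
  intro σ hσ hσ2 hH a₀ θ₀ u₀ ha hθ hu ha0 hθ0 T ρ θ u hE η₃ hTC hpack Φ γ C φ hγ hγ' hker t ht htT c₁ lam Cexp
    hc₁ hc₁σ hlam δs hδ0 G hGm hGgood hGz hGd hLed1
  have hσhalf : σ ≤ 1 / 2 := by
    have h := hσ2; norm_num at h ⊢; linarith
  have hKS : Icc (0 : ℝ) t ⊆ Ico 0 T := Icc_subset_Ico_right htT
  -- the kernel family
  obtain ⟨hφs, hφ0, hφ1, hφsupp, hφb, -⟩ := hker
  -- the laws
  set P : (N : ℕ) → Measure (Config (N + 1) (Fin 3) T3) := fun N => localGibbsLaw σ a₀ u₀ θ₀ N (Φ N)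
    with hP
  haveI hPprob : ∀ N, IsProbabilityMeasure (P N) := fun N =>
    isProbabilityMeasure_localGibbsLaw ha hθ hu ha0 hθ0 hσhalf N (Φ N)
  -- clause 3 of `ThermoChamber`: smoothness and explicit form of `Λ`; the entropy variables
  obtain ⟨hΛ0, hΛeq, -, -⟩ := (hTC σ hσ).2.2 T ρ θ u hE hpack
  have hΛ : Torus.IsSmoothSpaceTimeOn (Ico 0 T) (Lcl σ ρ θ u) := hΛ0
  have h0 : Torus.IsSmoothSpaceTimeOn (Ico 0 T) (lam0 σ ρ θ u) := by
    refine (hΛ0.clm_comp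
      (ContinuousLinearMap.apply ℝ ℝ (((1 : ℝ), ((0 : V3), (0 : ℝ))) : State))).congr ?_
    rintro ⟨s, y⟩ hp
    have hs : s ∈ Ico 0 T := (mem_prod.1 hp).1
    simp only [Torus.stLift_apply, ContinuousLinearMap.apply_apply]
    rw [hΛeq s hs]
    simp [lam0]
  have hθinv : Torus.IsSmoothSpaceTimeOn (Ico 0 T) (fun s x => (θ s x)⁻¹) :=
    ContDiffOn.inv hE.smooth_temperature fun p hp =>
      (hE.temperature_pos p.1 (mem_prod.1 hp).1 (Torus.proj p.2)).ne'
  have hMst : Torus.IsSmoothSpaceTimeOn (Ico 0 T) (lamM θ u) := hθinv.smul hE.smooth_velocity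
  have hEst : Torus.IsSmoothSpaceTimeOn (Ico 0 T) (lamE θ) := hθinv.neg
  have hU : Torus.IsSmoothSpaceTimeOn (Ico 0 T) (Ucl ρ θ u) := isSmoothSpaceTimeOn_stateOf hE
  -- uniform bounds on the compact `[0, t] × T³`
  obtain ⟨A0, hA0⟩ := h0.exists_norm_le_of_isCompact isCompact_Icc hKS
  obtain ⟨AM, hAM⟩ := hMst.exists_norm_le_of_isCompact isCompact_Icc hKS
  obtain ⟨AE, hAE⟩ := hEst.exists_norm_le_of_isCompact isCompact_Icc hKS
  obtain ⟨AΛ, hAΛ⟩ := hΛ.exists_norm_le_of_isCompact isCompact_Icc hKS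
  obtain ⟨AU, hAU⟩ := hU.exists_norm_le_of_isCompact isCompact_Icc hKS
  -- the uniform second moment of the energy per particle
  obtain ⟨M₀, hM₀⟩ := stub_clausius_moment a₀ θ₀ u₀ ha hθ hu ha0 hθ0 σ hσhalf
  have hM₀0 : 0 ≤ M₀ := (integral_nonneg fun z => sq_nonneg _).trans (hM₀ 0 (Φ 0)).2
  -- the two sure constants
  obtain ⟨K₁, hK₁, HK₁⟩ := engine_productionBound σ hσ hH T ρ θ u hE η₃ hTC hpack t ht htT c₁ hc₁ hc₁σ lam hlam
  obtain ⟨Cb, hCb, HCb⟩ := engine_incrementIdentity σ hσ hσ2 hH T ρ θ u hE η₃ hTC hpack t ht htT c₁ hc₁ hc₁σ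
  -- the constants of the bound
  set K : ℝ := K₁ * max 1 Cexp with hKdef
  have hK : 0 ≤ K := mul_nonneg hK₁ (zero_le_one.trans (le_max_left _ _))
  set r : ℕ → ℝ := fun N => ((N : ℝ) + 1) ^ (-γ) with hr
  have hr0 : ∀ N, 0 ≤ r N := fun N => Real.rpow_nonneg (by positivity) _
  set err : ℕ → ℝ := fun N => max (δs N) 0 + Cb * r N * (2 * t + 2 / lam ^ 2 * |Cexp|) +
    Cb * Real.sqrt (max (δs N) 0 * t) * (M₀ + 2) with herr
  have herr0 : Tendsto err atTop (𝓝 0) := by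
    have hδ' : Tendsto (fun N => max (δs N) 0) atTop (𝓝 0) := hδ0.max_left
    have hrN : Tendsto r atTop (𝓝 0) :=
      (tendsto_rpow_neg_atTop hγ).comp (tendsto_atTop_add_const_right _ _ tendsto_natCast_atTop_atTop)
    have h2 : Tendsto (fun N => Cb * r N * (2 * t + 2 / lam ^ 2 * |Cexp|)) atTop (𝓝 0) := by
      simpa using (hrN.const_mul Cb).mul_const (2 * t + 2 / lam ^ 2 * |Cexp|)
    have h3 : Tendsto (fun N => Cb * Real.sqrt (max (δs N) 0 * t) * (M₀ + 2)) atTop (𝓝 0) := by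
      have hs : Tendsto (fun N => Real.sqrt (max (δs N) 0 * t)) atTop (𝓝 0) := by
        simpa using (hδ'.mul_const t).sqrt
      simpa using (hs.const_mul Cb).mul_const (M₀ + 2)
    simpa [herr] using (hδ'.add h2).add h3
  -- eventually: two particles per band block
  have e2 := Clausius.eventually_kernel_lt (C := C) (by linarith : 3 * γ < 1) hc₁
  set B₀ : ℝ := (A0 + 3 * AM / 2 + AΛ * AU) + (3 * AM + AE) * (M₀ + 1) with hB₀
  have both : ∀ᶠ N : ℕ in atTop,
      (IntegrableOn (fun τ => ∫ z, (G N).indicator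
          (fun z => ∫ x, relEnt σ (bU (φ N) ((Φ N).flow τ z) x) (Ucl ρ θ u τ x)) z ∂(P N)) (Icc 0 t) ∧
        ∀ τ ∈ Icc 0 t, 0 ≤ ∫ z, (G N).indicator
          (fun z => ∫ x, relEnt σ (bU (φ N) ((Φ N).flow τ z) x) (Ucl ρ θ u τ x)) z ∂(P N)) ∧
      ∀ M : ℝ, 1 ≤ M → ∀ s ∈ Icc 0 t,
        (∫ z, (G N).indicator
            (fun z => obs σ ρ θ u 0 ((Φ N).flow 0 z) - ∫ x, Lcl σ ρ θ u 0 x (Ucl ρ θ u 0 x)) z ∂(P N)) -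
          ∫ z, (G N).indicator
            (fun z => obs σ ρ θ u s ((Φ N).flow s z) - ∫ x, Lcl σ ρ θ u s x (Ucl ρ θ u s x)) z ∂(P N) ≤
        K * Real.sqrt M * (∫ τ in Icc 0 s, ∫ z, (G N).indicator
            (fun z => ∫ x, relEnt σ (bU (φ N) ((Φ N).flow τ z) x) (Ucl ρ θ u τ x)) z ∂(P N)) +
          K * Real.sqrt M * Real.exp (-(lam * M / 4)) + err N := by
    filter_upwards [hLed1, e2] with N hN1 hN2
    -- abbreviations
    set X : ℝ → Config (N + 1) (Fin 3) T3 → ℝ :=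
      fun τ z => ∫ x, relEnt σ (bU (φ N) ((Φ N).flow τ z) x) (Ucl ρ θ u τ x) with hX
    set Y : ℝ → Config (N + 1) (Fin 3) T3 → ℝ :=
      fun τ z => obs σ ρ θ u τ ((Φ N).flow τ z) - ∫ x, Lcl σ ρ θ u τ x (Ucl ρ θ u τ x) with hY
    set Hf : ℝ → ℝ := fun τ => ∫ z, (G N).indicator (X τ) z ∂(P N) with hHf
    set e : Config (N + 1) (Fin 3) T3 → ℝ := fun z => empiricalEnergyField z fun _ => (1 : ℝ) with he
    have hN1' : ∀ s ∈ Icc 0 t, Integrable ((G N).indicator (X s)) (P N) ∧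
        Integrable ((G N).indicator (Y s)) (P N) ∧
        (∫ z, (G N).indicator (X s) z ∂(P N)) + ∫ z, (G N).indicator (Y s) z ∂(P N) ≤ 1 := hN1
    have hφc : Continuous (φ N) := (hφs N).continuous
    have hNb : C * ((N : ℝ) + 1) ^ (3 * γ) < ((N + 1 : ℕ) : ℝ) * c₁ := hN2
    -- strictness of the kinetic inequality on `G`, the production bound, `relEnt ≥ 0`
    have hstrict : ∀ z ∈ G N, ∀ τ ∈ Icc 0 t, ∀ x,
        ‖bm (φ N) ((Φ N).flow τ z) x‖ ^ 2 < 2 * bρ (φ N) ((Φ N).flow τ z) x * bE (φ N) ((Φ N).flow τ z) x :=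
      fun z hz τ hτ x => (EngineReadout.strict_of_band (hφ0 N) (hφb N) hNb ((hGz N z hz).2.1 τ hτ)
        (hGd N z hz τ hτ) x).1
    have hS1 : ∀ M : ℝ, 1 ≤ M → ∀ z ∈ G N, ∀ τ ∈ Icc 0 t,
        Continuous (fun x => relEnt σ (bU (φ N) ((Φ N).flow τ z) x) (Ucl ρ θ u τ x)) ∧
        (∀ x, 0 ≤ relEnt σ (bU (φ N) ((Φ N).flow τ z) x) (Ucl ρ θ u τ x)) ∧
        prodCl σ T ρ θ u τ - prodBlock σ T ρ θ u (φ N) τ ((Φ N).flow τ z) ≤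
          K₁ * Real.sqrt M * X τ z + K₁ * Real.sqrt M * Real.exp (-(lam * M / 4)) *
            ∫ y, Real.exp (lam * ‖y.2‖ ^ 2) ∂(empiricalMeasure ((Φ N).flow τ z)) :=
      fun M hM z hz τ hτ => HK₁ M hM N (φ N) (hφs N) (hφ0 N) (hφ1 N) ((Φ N).flow τ z)
        ((hGz N z hz).2.1 τ hτ) (hstrict z hz τ hτ) τ hτ
    have hGX0 : ∀ τ ∈ Icc 0 t, ∀ z, 0 ≤ (G N).indicator (X τ) z := by
      intro τ hτ z
      by_cases hz : z ∈ G N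
      · rw [indicator_of_mem hz]; exact integral_nonneg (hS1 1 le_rfl z hz τ hτ).2.1
      · rw [indicator_of_notMem hz]
    have hH0 : ∀ τ ∈ Icc 0 t, 0 ≤ Hf τ := fun τ hτ => integral_nonneg (hGX0 τ hτ)
    -- the uniform bound `H_τ ≤ 1 + B₀`
    have he_int : Integrable e (P N) :=
      (EngineEntropyLedger.integral_energy_le (hM₀ N (Φ N)).1 (hM₀ N (Φ N)).2).1
    have he_le : ∫ z, e z ∂(P N) ≤ M₀ + 1 :=
      (EngineEntropyLedger.integral_energy_le (hM₀ N (Φ N)).1 (hM₀ N (Φ N)).2).2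
    have he0 : ∀ z, 0 ≤ e z := fun z => Clausius.empiricalEnergyField_one_nonneg z
    have hHle : ∀ τ ∈ Icc 0 t, Hf τ ≤ 1 + B₀ := by
      intro τ hτ
      have hA0' : ∀ x, |lam0 σ ρ θ u τ x| ≤ A0 := fun x => by
        simpa only [Real.norm_eq_abs] using hA0 τ hτ x
      have hAM' : ∀ x j, |lamM θ u τ x j| ≤ AM := fun x j => by
        have h1 : |lamM θ u τ x j| ≤ ‖lamM θ u τ x‖ := by simpa using PiLp.norm_apply_le (lamM θ u τ x) j
        exact h1.trans (hAM τ hτ x)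
      have hAE' : ∀ x, |lamE θ τ x| ≤ AE := fun x => by
        simpa only [Real.norm_eq_abs] using hAE τ hτ x
      have hℓ := EngineIncrementBound.ell_bound (P N) (Φ N) (hGgood N) hA0' hAM' hAE' (hAΛ τ hτ) (hAU τ hτ)
        he_int he_le (hN1' τ hτ).2.1
      have h := (hN1' τ hτ).2.2
      have h3 := neg_abs_le (∫ z, (G N).indicator (Y τ) z ∂(P N))
      change ∫ z, (G N).indicator (X τ) z ∂(P N) ≤ 1 + B₀
      linarith
    -- TONELLI on `[0, s] × Ω`
    have hFub : ∀ s ∈ Icc 0 t, 0 < s →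
        IntegrableOn Hf (Icc 0 s) ∧
        Integrable (fun z => (G N).indicator (fun z => ∫ τ in Icc 0 s, X τ z) z) (P N) ∧
        ∫ z, (G N).indicator (fun z => ∫ τ in Icc 0 s, X τ z) z ∂(P N) = ∫ τ in Icc 0 s, Hf τ := by
      intro s hs hs0
      have hsub : Icc (0 : ℝ) s ⊆ Icc 0 t := Icc_subset_Icc le_rfl hs.2
      have hmeas : AEStronglyMeasurable (fun p : ℝ × Config (N + 1) (Fin 3) T3 =>
          (G N).indicator (fun z => ∫ x, relEnt σ (bU (φ N) ((Φ N).flow p.1 z) x) (Ucl ρ θ u p.1 x)) p.2)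
          ((volume.restrict (Icc 0 s)).prod (P N)) :=
        engine_jointMeasurable σ hσ hH T ρ θ u hE η₃ hTC hpack s hs0 (hs.2.trans_lt htT) c₁ hc₁ hc₁σ N (Φ N)
          (φ N) hφc (P N) (localGibbsLaw_compl_good σ a₀ θ₀ u₀ N (Φ N)) (G N) (hGm N) (hGgood N)
          (fun z hz τ hτ x => (hGz N z hz).2.1 τ (hsub hτ) x)
      exact engine_incrementBound_tonelli (P N) (G N) X s (1 + B₀) hmeas (fun τ hτ => hGX0 τ (hsub hτ))
        (fun τ hτ => (hN1' τ (hsub hτ)).1) (fun τ hτ => hHle τ (hsub hτ))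
    refine ⟨⟨(hFub t ⟨ht.le, le_rfl⟩ ht).1, hH0⟩, ?_⟩
    -- THE INCREMENT BOUND
    intro M hM s hs
    have hsM : 0 ≤ Real.sqrt M := Real.sqrt_nonneg M
    set brk : ℝ := K * Real.sqrt M * Real.exp (-(lam * M / 4)) + max (δs N) 0 +
      Cb * r N * (2 * t + 2 / lam ^ 2 * |Cexp|) with hbrk
    have hbrk0 : 0 ≤ brk := by
      have : 0 ≤ Cb * r N * (2 * t + 2 / lam ^ 2 * |Cexp|) :=
        mul_nonneg (mul_nonneg hCb (hr0 N)) (by positivity)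
      have h2 : 0 ≤ max (δs N) 0 := le_max_right _ _
      positivity
    set cN : ℝ := Cb * Real.sqrt (max (δs N) 0 * t) with hcN
    have hcN0 : 0 ≤ cN := mul_nonneg hCb (Real.sqrt_nonneg _)
    -- pathwise on `G`
    have hpath : ∀ z ∈ G N, Y 0 z - Y s z ≤
        K₁ * Real.sqrt M * (∫ τ in Icc 0 s, X τ z) + brk + cN * (1 + e z) := by
      intro z hz
      have hzg : z ∈ (Φ N).good := hGgood N hz
      obtain ⟨hCexp, hband, hdef, hcc⟩ := hGz N z hz
      obtain ⟨iPB, iPC, iK, iCC, iD, i3, iA⟩ := engine_trajectoryIntegrable σ hσ hσ2 hH T ρ θ u hE η₃ hTC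
        hpack t ht htT c₁ hc₁ hc₁σ N (Φ N) (φ N) (hφs N) (hφ0 N) (hφ1 N) z hzg hband
      have iX : IntegrableOn (fun τ => X τ z) (Icc 0 t) :=
        engine_relEntTimeIntegrable σ hσ hH T ρ θ u hE η₃ hTC hpack t ht htT c₁ hc₁ hc₁σ N (Φ N) (φ N)
          (C * ((N : ℝ) + 1) ^ (3 * γ)) (hφs N) (hφ0 N) (hφb N) hNb z hzg hband (hGd N z hz)
      have hid := HCb N (Φ N) (φ N) (r N) (hφs N) (hφ0 N) (hφ1 N) (hφsupp N) z hzg hband iPB iPC iK iCC iD i3 s hs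
      have hY0 : Y 0 z = obs σ ρ θ u 0 z - ∫ x, Lcl σ ρ θ u 0 x (Ucl ρ θ u 0 x) := by
        simp only [hY, (Φ N).flow_zero z hzg]
      rw [hY0]
      exact EngineIncrementBound.pathwise (Φ N) (φ N) hs ht hlam (le_max_right _ _) (hr0 N) hK₁ hCb hKdef
        iPB iPC iX (iA lam) i3 (fun τ hτ => (hS1 M hM z hz τ hτ).2.2) hid hCexp
        (hdef.trans (le_max_left _ _)) ((hcc s hs).trans (le_max_left _ _))
    -- integrate over `z`
    by_cases hs0 : s = 0
    · subst hs0
      have hKM : 0 ≤ K * Real.sqrt M * (∫ τ in Icc (0 : ℝ) 0, Hf τ) := by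
        rw [Icc_self, Measure.restrict_singleton]
        simp
      show (∫ z, (G N).indicator (Y 0) z ∂(P N)) - ∫ z, (G N).indicator (Y 0) z ∂(P N) ≤
        K * Real.sqrt M * (∫ τ in Icc (0 : ℝ) 0, Hf τ) + K * Real.sqrt M * Real.exp (-(lam * M / 4)) + err N
      have herrN : 0 ≤ err N := by
        rw [herr]
        have h2 : 0 ≤ max (δs N) 0 := le_max_right _ _
        have : 0 ≤ Cb * r N * (2 * t + 2 / lam ^ 2 * |Cexp|) :=
          mul_nonneg (mul_nonneg hCb (hr0 N)) (by positivity)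
        positivity
      have : 0 ≤ K * Real.sqrt M * Real.exp (-(lam * M / 4)) := by positivity
      linarith
    have hs0' : 0 < s := lt_of_le_of_ne hs.1 (Ne.symm hs0)
    obtain ⟨-, hGint, hGeq⟩ := hFub s hs hs0'
    have hI0 : Integrable ((G N).indicator (Y 0)) (P N) := (hN1' 0 ⟨le_rfl, ht.le⟩).2.1
    have hIs : Integrable ((G N).indicator (Y s)) (P N) := (hN1' s hs).2.1
    have hpt : ∀ z, (G N).indicator (Y 0) z - (G N).indicator (Y s) z ≤
        K₁ * Real.sqrt M * (G N).indicator (fun z => ∫ τ in Icc 0 s, X τ z) z +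
          (G N).indicator (fun _ => brk) z + cN * (1 + e z) := by
      intro z
      by_cases hz : z ∈ G N
      · simp only [indicator_of_mem hz]
        exact hpath z hz
      · simp only [indicator_of_notMem hz]
        nlinarith [he0 z, hcN0]
    have h1i : Integrable (fun z => K₁ * Real.sqrt M * (G N).indicator (fun z => ∫ τ in Icc 0 s, X τ z) z) (P N) :=
      hGint.const_mul _
    have h2i : Integrable (fun z => (G N).indicator (fun _ => brk) z) (P N) :=
      (integrable_const brk).indicator (hGm N)
    have h3i : Integrable (fun z => cN * (1 + e z)) (P N) := ((integrable_const _).add he_int).const_mul _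
    have h12i : Integrable (fun z => K₁ * Real.sqrt M * (G N).indicator (fun z => ∫ τ in Icc 0 s, X τ z) z +
        (G N).indicator (fun _ => brk) z) (P N) := h1i.add h2i
    have hRint : Integrable (fun z => K₁ * Real.sqrt M * (G N).indicator (fun z => ∫ τ in Icc 0 s, X τ z) z +
        (G N).indicator (fun _ => brk) z + cN * (1 + e z)) (P N) := h12i.add h3i
    have hmono := integral_mono (hI0.sub hIs) hRint hpt
    rw [integral_sub' hI0 hIs] at hmono
    have hRHS : ∫ z, (K₁ * Real.sqrt M * (G N).indicator (fun z => ∫ τ in Icc 0 s, X τ z) z +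
        (G N).indicator (fun _ => brk) z + cN * (1 + e z)) ∂(P N) =
        K₁ * Real.sqrt M * (∫ τ in Icc 0 s, Hf τ) + brk * (P N).real (G N) + cN * (1 + ∫ z, e z ∂(P N)) := by
      rw [integral_add h12i h3i, integral_add h1i h2i, integral_const_mul, integral_const_mul,
        integral_indicator_const _ (hGm N), integral_add (integrable_const _) he_int, integral_const, hGeq]
      simp only [smul_eq_mul, probReal_univ, one_mul]
      ring
    rw [hRHS] at hmono
    -- bookkeeping
    have hPG : (P N).real (G N) ≤ 1 := measureReal_le_one
    have hPG0 : 0 ≤ (P N).real (G N) := measureReal_nonneg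
    have hbrk_le : brk * (P N).real (G N) ≤ brk := by nlinarith
    have hce : cN * (1 + ∫ z, e z ∂(P N)) ≤ cN * (M₀ + 2) :=
      mul_le_mul_of_nonneg_left (by linarith [he_le]) hcN0
    have hint0 : 0 ≤ ∫ τ in Icc 0 s, Hf τ :=
      setIntegral_nonneg measurableSet_Icc fun τ hτ => hH0 τ (Icc_subset_Icc le_rfl hs.2 hτ)
    have hK1K : K₁ * Real.sqrt M * (∫ τ in Icc 0 s, Hf τ) ≤ K * Real.sqrt M * (∫ τ in Icc 0 s, Hf τ) := by
      rw [hKdef]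
      have : K₁ ≤ K₁ * max 1 Cexp := le_mul_of_one_le_right hK₁ (le_max_left _ _)
      exact mul_le_mul_of_nonneg_right (mul_le_mul_of_nonneg_right this hsM) hint0
    have herrN : brk + cN * (M₀ + 2) = K * Real.sqrt M * Real.exp (-(lam * M / 4)) + err N := by
      rw [hbrk, herr, hcN]; ring
    show (∫ z, (G N).indicator (Y 0) z ∂(P N)) - ∫ z, (G N).indicator (Y s) z ∂(P N) ≤
      K * Real.sqrt M * (∫ τ in Icc 0 s, Hf τ) + K * Real.sqrt M * Real.exp (-(lam * M / 4)) + err N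
    linarith
  exact ⟨K, hK, err, herr0, both.mono fun N h => h.1, fun M hM => both.mono fun N h => h.2 M hM⟩

end Barycentric

end Summit.AtomisticToContinuum.HydrodynamicLimit.Theorems.MacroClosureLine

end
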